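import Summits.Ventures.YMGap.YM4Door.SpeciesTransport

/-!
# YM4Door / HaarForm — the hand-over door is a REGION: the Haar form of a blocked Gibbs density, the door conditions
# `AtDoorCell` / `AtHaarDoor` / `AtBasin` ⇒ block-level IR and block-observable clustering, the price of the β-axis

HONEST FRAMING (cell `ym-beyond`, seat P2 «strong-coupling bridge», HUMAN RULING D-0035 / D-0037; tree edition, g8,
2026-08-25, of the part of the farm-checked HOME sketch `HOME/ROUTE-P2-SketchDoor.lean` v0.4 sha16 77848c24fc60f2e6 that
is not already in `YM4Door/StripDoor|StripCells|WilsonPrice.lean` (the cells, `DoorCell`, `SU2.BlockClusters`, the Wilson price) or in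
`YM4Door/BlockTransport.lean` + `YM4Door/SpeciesTransport.lean` (the push-forward lemmas, `SU2.μW`, `SU2.AtTorusDoor`) — namespace `YMBeyond.P2.Door` →
`Summit.Ventures.YMGap.YM4Door`; memo `HOME/ROUTE-P2.md` §4c, §5; referee baseline v0.7 PASS).  LATTICE / finite-torus
bookkeeping only: nothing here is a continuum, spectral or Clay-sense statement; nothing here moves the weak-coupling
exit of Track A (uncertified); nothing here is a part of Bałaban's theorems; NO effective action is asserted to be at any
door.  NO conjecture name, NO `sorry`, NO axiom beyond the standard three; label K = kernel bookkeeping.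

* §1 the Haar SLIVER as a door cell (`doorCell_haarSliver`: tree `β₀ = (1/500)/(e^{ε₀}·1.9428…)`, loads `(ε₀, 1/3)`).
* §2 THE HAAR FORM.  The split `β'·S_W + ∑ E_X` of a Bałaban effective action is NOT fixed by `IsBalabanEffectiveActionOf`
  (only the density is): `⟨β', E⟩` and `haarForm … = ⟨0, E + β'•wilson⟩` have the same density, the same blocked-law
  identity and the same perturbed measure (`perturbedMeasure_add_smul_wilson` — coupling shift for perturbed measures;
  `density_haarForm`, `isBalabanEffectiveActionOf_haarForm_iff`, `perturbedMeasure_haarForm`).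
* §3 BLOCK-LEVEL IR, DOOR-FREE; EVERY CELL IS A SUFFICIENT CONDITION: `SU2.AtDoorCell` (g3's `AtTorusDoor` is the cell
  `(1/6; 11/500, 11/1000)`, `atDoorCell_oneThird_iff`), `SU2.AtHaarDoor`; cell ⇒ `ClustersWith` ⇒ `BlockClusters`
  (`clustersWith_of_atDoorCell`, `blockClusters_of_atDoorCell`, `blockClusters_of_atHaarDoor`); the Haar re-expression of
  any witness (`blockLaw_haarForm`); BLOCK OBSERVABLES of the fine theory cluster at the block rate
  (`SU2.BlockObservablesCluster`, `blockObservablesCluster_of_blockClusters` through `covariance_comp_link`).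
* §4 numeric consequences of the certified Wilson price (`StripDoor` §8), all HYPOTHESIS-FREE: the milli-Wilson fifth cell
  `clustersWith_milli_fifth` (`κ = 1/100`, `|β| ≤ 1/1000`, `ε₁ ≤ 1/5`); pure Wilson theory at `|β| ≤ 1/320` clusters by
  the ball calculus alone, both signs (`clustersWith_pureWilson_small` — the first rung of the strong-coupling expansion
  recovered format-free); `price_of_third_cell`: relabelling the `1/3` cell's Wilson axis (`β ≤ 1/6`) would cost Lipschitz
  radius `> 17 = 51 × (1/3)` — the menu's coupling axis is NOT exchangeable for radius at the door edge, as a certified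
  inequality.
* §5 THE BASIN AS A DOOR CONDITION (coupling inside): `SU2.AtBasin` (`ε₁ + 72√2·e^κ·|𝓔.β| ≤ 1/3`, either sign),
  `clustersWith_of_atBasin`, `atBasin_of_atHaarDoor`, `blockClusters_of_atBasin`, `blockObservablesCluster_of_atBasin`.

NOT HERE: THE NUMBER (memo §2; the door edge `β_W,eff ≤ 1/3` vs the uncertified exit); the open door and the crossover
operator (`YM4Door/OpenDoor.lean`).

References: H. Föllmer, LNM 1362 (1988) Ch. I; T. Bałaban, CMP 119 (1988) §2 (2.23) [Balaban1988Convergent]; tree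
`Summits/Ventures/YMGap/RobustBall/{Defs,TorusRowsSU2StarW,PlaquetteMember,BallClosureTorus}.lean`,
`Literature/…/BlockScaleEffectivePerturbation.lean`, `…/QuasiLocalGaugePerturbationWilson.lean`.
-/

noncomputable section

open MeasureTheory ProbabilityTheory Finset Function
open Literature.Probability.LatticeModels Literature.Probability.LatticeModels.DobrushinMetric
open Literature.MathematicalPhysics.QuantumLattice hiding torusNorm configShift
open Literature.MathematicalPhysics.QuantumFieldTheory hiding ZdEdge
open Summit.Ventures.YMGap.RobustBall
open Summit.Ventures.YMGap.StarResolventDim (Delta gaugeR doorPoly)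

namespace Summit.Ventures.YMGap.YM4Door

variable {d L N : ℕ} [NeZero L]

/-! ## §1  The Haar sliver as a door cell (the cells themselves: `StripDoor` §4b, §5, §7) -/

/-- NEW cell, the Haar sliver (`StripDoor` §4b): tree `β₀ = (1/500)/(e^{ε₀}·1.9428…)`, loads `(ε₀, 1/3)`, any `ε₀ ≥ 0`. -/
theorem doorCell_haarSliver {ε₀ : ℝ} (hε₀ : 0 ≤ ε₀) :
    DoorCell ((1 / 500) / (Real.exp ε₀ * (1 + 2 * (1.41422 : ℝ) * (1 / 3)))) ε₀ (1 / 3) :=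
  fun κ hκ β hβ0 hβ => su2_torusClusteringOnBallW_star_haarSliver_t100 κ hκ ε₀ hε₀ β hβ0 hβ

/-! ## §2  The split `β'·S_W + ∑ E_X` is not fixed by the blocked density: the Haar form -/

section HaarForm

variable {d N L c : ℕ} [NeZero L] {G : Type*} [Group G] [TopologicalSpace G] [IsTopologicalGroup G]
  [MeasurableSpace G] [BorelSpace G] [SecondCountableTopology G] [CompactSpace G]
  (ρ : G →* Matrix (Fin N) (Fin N) ℂ) (hρ : Continuous ρ)

/-- **Coupling shift for perturbed WEIGHTS**: `(W + β'•wilson).weight β = W.weight (β + β')`. -/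
theorem weight_add_smul_wilson (W : QuasiLocalGaugePerturbation d L G c) (β β' : ℝ) :
    (W + β' • QuasiLocalGaugePerturbation.wilson (d := d) (L := L) ρ hρ c).weight ρ β = W.weight ρ (β + β') := by
  have h : (W + β' • QuasiLocalGaugePerturbation.wilson (d := d) (L := L) ρ hρ c).total =
      fun U => W.total U + β' * wilsonAction ρ U := by
    rw [QuasiLocalGaugePerturbation.total_add, QuasiLocalGaugePerturbation.total_smul,
      QuasiLocalGaugePerturbation.total_wilson]
    rfl
  simp only [QuasiLocalGaugePerturbation.weight, h]
  congr 1
  funext U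
  rw [show -β * wilsonAction ρ U - (W.total U + β' * wilsonAction ρ U) = -(β + β') * wilsonAction ρ U - W.total U by
    ring]

/-- Coupling shift for perturbed partition functions. -/
theorem partitionFunction_add_smul_wilson (W : QuasiLocalGaugePerturbation d L G c) (β β' : ℝ) :
    (W + β' • QuasiLocalGaugePerturbation.wilson (d := d) (L := L) ρ hρ c).partitionFunction ρ β =
      W.partitionFunction ρ (β + β') := by
  simp only [QuasiLocalGaugePerturbation.partitionFunction, weight_add_smul_wilson]

/-- **Coupling shift for perturbed MEASURES**: the torus theory with action `β S_W + (W + β' S_W)` is the one with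
action `(β + β') S_W + W` — absorbing (part of) the Wilson term into the perturbation changes nothing. -/
theorem perturbedMeasure_add_smul_wilson (W : QuasiLocalGaugePerturbation d L G c) (β β' : ℝ) :
    (W + β' • QuasiLocalGaugePerturbation.wilson (d := d) (L := L) ρ hρ c).perturbedMeasure ρ β =
      W.perturbedMeasure ρ (β + β') := by
  simp only [QuasiLocalGaugePerturbation.perturbedMeasure, partitionFunction_add_smul_wilson, weight_add_smul_wilson]

variable {S : ℕ} [NeZero S]

/-- **The HAAR FORM of a Bałaban effective action**: the whole action, Wilson part included, as ONE quasi-local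
perturbation of the ZERO action — `⟨β', E⟩ ↦ ⟨0, E + β'•wilson⟩`. -/
def haarForm (𝓔 : BalabanEffectiveAction d S G c) : BalabanEffectiveAction d S G c :=
  ⟨0, 𝓔.terms + 𝓔.β • QuasiLocalGaugePerturbation.wilson (d := d) (L := S) ρ hρ c⟩

/-- The Haar form has zero coupling. -/
@[simp] theorem haarForm_β (𝓔 : BalabanEffectiveAction d S G c) : (haarForm ρ hρ 𝓔).β = 0 := rfl

/-- The terms of the Haar form: the old terms plus the Wilson part moved inside. -/
@[simp] theorem haarForm_terms (𝓔 : BalabanEffectiveAction d S G c) :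
    (haarForm ρ hρ 𝓔).terms = 𝓔.terms + 𝓔.β • QuasiLocalGaugePerturbation.wilson (d := d) (L := S) ρ hρ c := rfl

/-- Same total action. -/
theorem total_haarForm (𝓔 : BalabanEffectiveAction d S G c) (V : GaugeConfig d S G) :
    (haarForm ρ hρ 𝓔).total ρ V = 𝓔.total ρ V := by
  simp only [haarForm, BalabanEffectiveAction.total, QuasiLocalGaugePerturbation.total_add,
    QuasiLocalGaugePerturbation.total_smul, QuasiLocalGaugePerturbation.total_wilson, Pi.add_apply, Pi.smul_apply,
    smul_eq_mul, zero_mul, zero_add]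
  ring

/-- Same density `e^{-𝓔(V)}`. -/
theorem density_haarForm (𝓔 : BalabanEffectiveAction d S G c) : (haarForm ρ hρ 𝓔).density ρ = 𝓔.density ρ := by
  funext V
  simp only [BalabanEffectiveAction.density, total_haarForm]

/-- **Split independence**: `IsBalabanEffectiveActionOf` sees only the density, so an effective action is "of
lattice Yang–Mills at `β` through `B`" iff its Haar form is. The statement H-b ("the last-scale action is
`β'·S_W + E` with `β' ≤ β₀` and `E` load-small") therefore quantifies over a CHOICE of split; §1 says the choice
`β' = 0` is admissible with the most generous Lipschitz budget and no oscillation budget at all. -/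
theorem isBalabanEffectiveActionOf_haarForm_iff {b : ℕ} [NeZero b] (B : GaugeBlockAveraging d G b S) (β : ℝ)
    (𝓔 : BalabanEffectiveAction d S G c) :
    IsBalabanEffectiveActionOf ρ B β (haarForm ρ hρ 𝓔) ↔ IsBalabanEffectiveActionOf ρ B β 𝓔 := by
  unfold IsBalabanEffectiveActionOf
  rw [density_haarForm]

/-- Same block-lattice Gibbs law: the perturbed measure of the Haar form at coupling `0` is that of `𝓔` at `𝓔.β`. -/
theorem perturbedMeasure_haarForm (𝓔 : BalabanEffectiveAction d S G c) :
    (haarForm ρ hρ 𝓔).terms.perturbedMeasure ρ 0 = 𝓔.terms.perturbedMeasure ρ 𝓔.β := by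
  rw [haarForm_terms, perturbedMeasure_add_smul_wilson, zero_add]

end HaarForm


/-! ## §3  Block-level IR, door-free; every cell is a sufficient condition -/

namespace SU2

/-- The fundamental representation of `SU(2)` is continuous. -/
theorem continuous_ρ2 : Continuous ρ2 := continuous_fundamentalRep (Fin 2)

variable {b S : ℕ} [NeZero b] [NeZero S]

/-- **AT THE DOOR CELL `(β₀; ε₀, ε₁)`**: effective coupling in `[0, β₀]`, terms in `InBall κ ε₀ ε₁`, `κ ≥ 1/100`
(g3's `AtTorusDoor` is the cell `(1/6; 11/500, 11/1000)`, `atDoorCell_oneThird_iff`). -/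
@[folklore] def AtDoorCell (𝓔 : BalabanEffectiveAction 4 S (SUN 2) 1) (κ β₀ ε₀ ε₁ : ℝ) : Prop :=
  0 ≤ 𝓔.β ∧ 𝓔.β ≤ β₀ ∧ 1 / 100 ≤ κ ∧ InBall κ ε₀ ε₁ 𝓔.terms

/-- … is the stingiest cell of the menu. -/
theorem atDoorCell_oneThird_iff (𝓔 : BalabanEffectiveAction 4 S (SUN 2) 1) (κ : ℝ) :
    AtDoorCell 𝓔 κ (1 / 6) (11 / 500) (11 / 1000) ↔ AtTorusDoor 𝓔 κ := Iff.rfl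

/-- **AT THE HAAR DOOR**: the whole action as a perturbation of the zero action (`𝓔.β = 0`), oscillation load `≤ ε₀`
(any `ε₀ ≥ 0`), Lipschitz load `≤ 1/3`, `κ ≥ 1/100`. -/
@[folklore] def AtHaarDoor (𝓔 : BalabanEffectiveAction 4 S (SUN 2) 1) (κ ε₀ : ℝ) : Prop :=
  𝓔.β = 0 ∧ 1 / 100 ≤ κ ∧ 0 ≤ ε₀ ∧ InBall κ ε₀ (1 / 3) 𝓔.terms

/-- The Haar door is the door cell `(0; ε₀, 1/3)`. -/
theorem atDoorCell_of_atHaarDoor {𝓔 : BalabanEffectiveAction 4 S (SUN 2) 1} {κ ε₀ : ℝ} (h : AtHaarDoor 𝓔 κ ε₀) :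
    AtDoorCell 𝓔 κ 0 ε₀ (1 / 3) :=
  ⟨h.1.symm.le, h.1.le, h.2.1, h.2.2.2⟩

/-- **Every cell clusters** (tree rows / §1, hypothesis-free): constant `16 e^{1/50}`, rate `1/100` in block units. -/
theorem clustersWith_of_atDoorCell (hS : 3 ≤ S) {β₀ ε₀ ε₁ : ℝ} (hcell : DoorCell β₀ ε₀ ε₁)
    (𝓔 : BalabanEffectiveAction 4 S (SUN 2) 1) {κ : ℝ} (h : AtDoorCell 𝓔 κ β₀ ε₀ ε₁) :
    ClustersWith 𝓔.terms 𝓔.β (16 * Real.exp (1 / 50)) (1 / 100) :=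
  hcell κ h.2.2.1 𝓔.β h.1 h.2.1 S hS 𝓔.terms h.2.2.2

/-- At the Haar door the action clusters at the tree constants. -/
theorem clustersWith_of_atHaarDoor (hS : 3 ≤ S) (𝓔 : BalabanEffectiveAction 4 S (SUN 2) 1) {κ ε₀ : ℝ}
    (h : AtHaarDoor 𝓔 κ ε₀) : ClustersWith 𝓔.terms 𝓔.β (16 * Real.exp (1 / 50)) (1 / 100) :=
  clustersWith_of_atDoorCell hS (doorCell_haar h.2.2.1) 𝓔 (atDoorCell_of_atHaarDoor h)


/-- Cell ⇒ block-level IR. -/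
theorem blockClusters_of_atDoorCell (hS : 3 ≤ S) {B : GaugeBlockAveraging 4 (SUN 2) b S} {β β₀ ε₀ ε₁ κ : ℝ}
    (hcell : DoorCell β₀ ε₀ ε₁) {𝓔 : BalabanEffectiveAction 4 S (SUN 2) 1} (h𝓔 : IsBalabanEffectiveActionOf ρ2 B β 𝓔)
    (hd : AtDoorCell 𝓔 κ β₀ ε₀ ε₁) : BlockClusters B β (16 * Real.exp (1 / 50)) (1 / 100) :=
  ⟨𝓔, h𝓔, clustersWith_of_atDoorCell hS hcell 𝓔 hd⟩

/-- Haar door ⇒ block-level IR. -/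
theorem blockClusters_of_atHaarDoor (hS : 3 ≤ S) {B : GaugeBlockAveraging 4 (SUN 2) b S} {β κ ε₀ : ℝ}
    {𝓔 : BalabanEffectiveAction 4 S (SUN 2) 1} (h𝓔 : IsBalabanEffectiveActionOf ρ2 B β 𝓔) (hd : AtHaarDoor 𝓔 κ ε₀) :
    BlockClusters B β (16 * Real.exp (1 / 50)) (1 / 100) :=
  ⟨𝓔, h𝓔, clustersWith_of_atHaarDoor hS 𝓔 hd⟩

/-- **Haar re-expression of ANY witness**: if `𝓔 = ⟨β', E⟩` witnesses the blocked law, so does its Haar form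
`⟨0, E + β'•wilson⟩`, with the same Gibbs law — so "being at SOME cell" may always be tested on the Haar form's ONE
number (its Lipschitz load), at the price of the Wilson part's own loads (memo §5.7: `≈ 130·β'` in site incidence). -/
theorem blockLaw_haarForm {B : GaugeBlockAveraging 4 (SUN 2) b S} {β : ℝ} {𝓔 : BalabanEffectiveAction 4 S (SUN 2) 1}
    (h𝓔 : IsBalabanEffectiveActionOf ρ2 B β 𝓔) :
    IsBalabanEffectiveActionOf ρ2 B β (haarForm ρ2 continuous_ρ2 𝓔) ∧
      (haarForm ρ2 continuous_ρ2 𝓔).terms.perturbedMeasure ρ2 0 = (μW β (b * S)).map B.link :=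
  ⟨(isBalabanEffectiveActionOf_haarForm_iff ρ2 continuous_ρ2 B β 𝓔).2 h𝓔,
    by rw [perturbedMeasure_haarForm, map_link_wilsonMeasure ρ2 h𝓔]⟩

/-- **IR FOR BLOCK OBSERVABLES (the door-free TARGET at block level)**: on the fine torus `b·S`, bounded measurable
block-local Lipschitz observables of the BLOCK FIELD `B.link U`, supported on block-link sets `Δf`, `Δg` at block
distance `≥ n`, have fine-state covariance `≤ A·(∑δg)(∑δf)·e^{−m n}` — clustering at rate `m` PER BLOCK. -/
@[folklore] def BlockObservablesCluster (B : GaugeBlockAveraging 4 (SUN 2) b S) (β A m : ℝ) : Prop :=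
  ∀ (f g : GaugeConfig 4 S (SUN 2) → ℝ) (Δf Δg : Finset (Edge 4 S)) (δf δg : Edge 4 S → ℝ) (n : ℕ),
    Measurable f → Measurable g → DependsOn f (↑Δf : Set (Edge 4 S)) →
    DependsOn g (↑Δg : Set (Edge 4 S)) → (∃ M, ∀ U, |f U| ≤ M) → (∃ M, ∀ U, |g U| ≤ M) →
    IsLipBound suFrobDist f δf → IsLipBound suFrobDist g δg →
    (∀ x ∈ Δf, ∀ y ∈ Δg, n ≤ torusNorm (x.1 - y.1)) →
      |cov[fun U => f (B.link U), fun U => g (B.link U); μW β (b * S)]| ≤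
        A * (∑ y ∈ Δg, δg y) * (∑ x ∈ Δf, δf x) * Real.exp (-m * n)

/-- **Block-level IR ⇒ IR for block observables** (exact pushforward, `covariance_comp_link`). -/
theorem blockObservablesCluster_of_blockClusters {B : GaugeBlockAveraging 4 (SUN 2) b S} {β A m : ℝ}
    (h : BlockClusters B β A m) : BlockObservablesCluster B β A m := by
  obtain ⟨𝓔, h𝓔, hcl⟩ := h
  intro f g Δf Δg δf δg n hf hg hfd hgd hfb hgb hfl hgl hsep
  rw [covariance_comp_link ρ2 h𝓔 hf hg]
  exact hcl f g Δf Δg δf δg n hf hg hfd hgd hfb hgb hfl hgl hsep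

/-- **COROLLARY — the menu at work**: at ANY certified cell, block observables of the fine `SU(2)` theory cluster at
rate `1/100` per block, constant `16 e^{1/50}`, on every block-commensurate torus `b·S`, `S ≥ 3`. -/
theorem blockObservablesCluster_of_atDoorCell (hS : 3 ≤ S) {B : GaugeBlockAveraging 4 (SUN 2) b S}
    {β β₀ ε₀ ε₁ κ : ℝ} (hcell : DoorCell β₀ ε₀ ε₁) {𝓔 : BalabanEffectiveAction 4 S (SUN 2) 1}
    (h𝓔 : IsBalabanEffectiveActionOf ρ2 B β 𝓔) (hd : AtDoorCell 𝓔 κ β₀ ε₀ ε₁) :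
    BlockObservablesCluster B β (16 * Real.exp (1 / 50)) (1 / 100) :=
  blockObservablesCluster_of_blockClusters (blockClusters_of_atDoorCell hS hcell h𝓔 hd)

/-- The Haar-door instance of the corollary. -/
theorem blockObservablesCluster_of_atHaarDoor (hS : 3 ≤ S) {B : GaugeBlockAveraging 4 (SUN 2) b S}
    {β κ ε₀ : ℝ} {𝓔 : BalabanEffectiveAction 4 S (SUN 2) 1} (h𝓔 : IsBalabanEffectiveActionOf ρ2 B β 𝓔)
    (hd : AtHaarDoor 𝓔 κ ε₀) : BlockObservablesCluster B β (16 * Real.exp (1 / 50)) (1 / 100) :=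
  blockObservablesCluster_of_blockClusters (blockClusters_of_atHaarDoor hS h𝓔 hd)

end SU2

/-! ## §4  Numeric consequences of the certified Wilson price (`StripDoor` §8), hypothesis-free -/

namespace SU2

open WilsonPrice

variable {L : ℕ} [NeZero L]

-- `1.41421 ≤ √2` is inlined at its single use below (the tree already has it as
-- `Literature.NumberTheory.LFunctions.SiegelIntegral.sqrt_two_ge`; not re-declared per the gate's dedup rule).


/-- **A numeric instance (the milli-Wilson fifth cell)**: at `κ = 1/100`, `|β| ≤ 1/1000` (`|β_W| ≤ 1/500`), `ε₀ ≥ 0`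
free, `ε₁ ≤ 1/5`: clustering, hypothesis-free (`1/5 + 72√2·e^{1/100}/1000 ≈ 0.303 ≤ 1/3`). -/
theorem clustersWith_milli_fifth {ε₀ ε₁ : ℝ} (hε₀ : 0 ≤ ε₀) (hε₁ : ε₁ ≤ 1 / 5) (hL : 3 ≤ L)
    {W : Perturbation 4 L 2} (hW : InBall (1 / 100) ε₀ ε₁ W) {β : ℝ} (hβ : |β| ≤ 1 / 1000) :
    ClustersWith W β (16 * Real.exp (1 / 50)) (1 / 100) := by
  refine clustersWith_of_smallWilson le_rfl hε₀ hL hW ?_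
  have h1 : Real.exp (1 / 100) * (72 * Real.sqrt 2 * |β|) ≤ 1.01006 * (72 * 1.41422 * (1 / 1000)) := by
    apply mul_le_mul exp_hundredth_le _ (by positivity) (by norm_num)
    apply mul_le_mul _ hβ (abs_nonneg β) (by positivity)
    exact mul_le_mul_of_nonneg_left sqrt_two_le (by norm_num)
  linarith

/-- **THE PRICE OF THE 1/3 CELL'S β-AXIS**: relabelling its Wilson part `β ≤ 1/6` (`β_W ≤ 1/3`) into the perturbation
costs Lipschitz radius `72√2·e^{1/100}/6 > 17`, i.e. more than `51` Haar-cell budgets (`1/3` each): the coupling axis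
of the menu is NOT exchangeable for radius at the door edge — as a certified inequality. -/
theorem price_of_third_cell : (17 : ℝ) < Real.exp (1 / 100) * (72 * Real.sqrt 2 * (1 / 6)) := by
  have he : (1.01 : ℝ) ≤ Real.exp (1 / 100) := by
    have := Real.add_one_le_exp (1 / 100 : ℝ); linarith
  have h : (1.01 : ℝ) * (72 * 1.41421 * (1 / 6)) ≤ Real.exp (1 / 100) * (72 * Real.sqrt 2 * (1 / 6)) := by
    apply mul_le_mul he _ (by norm_num) (Real.exp_pos _).le
    exact mul_le_mul_of_nonneg_right (mul_le_mul_of_nonneg_left (show (1.41421 : ℝ) ≤ Real.sqrt 2 by rw [Real.le_sqrt (by norm_num) (by norm_num)]; norm_num) (by norm_num)) (by norm_num)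
  linarith

/-- … and the Haar-cell ABSORPTION THRESHOLD: a Wilson part `|β| ≤ 1/320` (`|β_W| ≤ 1/160 ≈ 6.3·10⁻³`) ALONE — `W = 0`,
i.e. pure Wilson theory near `β = 0` of either sign — is absorbed (`72√2·e^{1/100}/320 ≈ 0.321 ≤ 1/3`): the strong-coupling
cluster expansion's first rung recovered INSIDE the ball calculus, format-free. -/
theorem clustersWith_pureWilson_small (hL : 3 ≤ L) {β : ℝ} (hβ : |β| ≤ 1 / 320) :
    ClustersWith (0 : Perturbation 4 L 2) β (16 * Real.exp (1 / 50)) (1 / 100) := by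
  have h0 : InBall (1 / 100) 0 0 (0 : Perturbation 4 L 2) := zero_mem_clusterDomain le_rfl le_rfl
  refine clustersWith_of_smallWilson le_rfl le_rfl hL h0 ?_
  have h1 : Real.exp (1 / 100) * (72 * Real.sqrt 2 * |β|) ≤ 1.01006 * (72 * 1.41422 * (1 / 320)) := by
    apply mul_le_mul exp_hundredth_le _ (by positivity) (by norm_num)
    apply mul_le_mul _ hβ (abs_nonneg β) (by positivity)
    exact mul_le_mul_of_nonneg_left sqrt_two_le (by norm_num)
  linarith


/-! ## §5  The basin as a door condition (coupling inside), feeding the same block-level glue as the cells -/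

variable {b S : ℕ} [NeZero b] [NeZero S]

/-- **AT THE BASIN**: `κ ≥ 1/100`, `ε₀ ≥ 0` free, the terms in `InBall κ ε₀ ε₁`, and the Wilson coefficient SMALL on
the Lipschitz axis: `ε₁ + 72√2·e^κ·|𝓔.β| ≤ 1/3` (either sign). -/
@[folklore] def AtBasin (𝓔 : BalabanEffectiveAction 4 S (SUN 2) 1) (κ ε₀ ε₁ : ℝ) : Prop :=
  1 / 100 ≤ κ ∧ 0 ≤ ε₀ ∧ InBall κ ε₀ ε₁ 𝓔.terms ∧ ε₁ + Real.exp κ * (72 * Real.sqrt 2 * |𝓔.β|) ≤ 1 / 3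

/-- At the basin the action clusters at the tree constants (the Wilson part priced on the load axes). -/
theorem clustersWith_of_atBasin (hS : 3 ≤ S) (𝓔 : BalabanEffectiveAction 4 S (SUN 2) 1) {κ ε₀ ε₁ : ℝ}
    (h : AtBasin 𝓔 κ ε₀ ε₁) : ClustersWith 𝓔.terms 𝓔.β (16 * Real.exp (1 / 50)) (1 / 100) :=
  clustersWith_of_smallWilson h.1 h.2.1 hS h.2.2.1 h.2.2.2

/-- The Haar door (`𝓔.β = 0`, Lipschitz load `1/3`) is the basin's centre. -/
theorem atBasin_of_atHaarDoor {𝓔 : BalabanEffectiveAction 4 S (SUN 2) 1} {κ ε₀ : ℝ} (h : AtHaarDoor 𝓔 κ ε₀) :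
    AtBasin 𝓔 κ ε₀ (1 / 3) := by
  refine ⟨h.2.1, h.2.2.1, h.2.2.2, ?_⟩
  rw [h.1, abs_zero, mul_zero, mul_zero, add_zero]

/-- A blocked Gibbs density at the basin gives block-level IR. -/
theorem blockClusters_of_atBasin (hS : 3 ≤ S) {B : GaugeBlockAveraging 4 (SUN 2) b S} {β κ ε₀ ε₁ : ℝ}
    {𝓔 : BalabanEffectiveAction 4 S (SUN 2) 1} (h𝓔 : IsBalabanEffectiveActionOf ρ2 B β 𝓔) (h : AtBasin 𝓔 κ ε₀ ε₁) :
    BlockClusters B β (16 * Real.exp (1 / 50)) (1 / 100) :=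
  ⟨𝓔, h𝓔, clustersWith_of_atBasin hS 𝓔 h⟩

/-- **COROLLARY — the basin at work**: block observables of the fine `SU(2)` theory cluster at rate `1/100` per block
whenever SOME Bałaban effective action of the blocking sits in the basin (coupling inside, either sign). -/
theorem blockObservablesCluster_of_atBasin (hS : 3 ≤ S) {B : GaugeBlockAveraging 4 (SUN 2) b S} {β κ ε₀ ε₁ : ℝ}
    {𝓔 : BalabanEffectiveAction 4 S (SUN 2) 1} (h𝓔 : IsBalabanEffectiveActionOf ρ2 B β 𝓔) (h : AtBasin 𝓔 κ ε₀ ε₁) :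
    BlockObservablesCluster B β (16 * Real.exp (1 / 50)) (1 / 100) :=
  blockObservablesCluster_of_blockClusters (blockClusters_of_atBasin hS h𝓔 h)

end SU2

end Summit.Ventures.YMGap.YM4Door

end
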